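/-
# Solo-blind programme on Kontsevich–Zagier, s6 part T5a: Rogers' form of the five-term relation

`SoloBlindFiveTerm.five_term` is Abel's form of the five-term relation, with a product of two
logarithmic classes on the right.  Rogers' normalisation removes it: with the **doubled Rogers
class** of a cut `x`,

  `R(x) = 2[D(x)] + ℓ(1/x)·ℓ(1/(1−x)) ∈ Q`     (period `2 Li₂(x) + log x · log(1−x) = 2 L(x)`),

the relation becomes homogeneous:

  `R(x) + R(y) = R(xy) + R(x ⋆ y) + R(y ⋆ x)`     (`rogers_five_term`),

for all real algebraic `0 < x, y < 1`.  The only extra input is the additivity `ℓ(ab) = ℓ(a) + ℓ(b)`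
of the logarithmic classes (`a, b > 1` algebraic), itself a consequence of the moves
(`SoloBlindBoxGenerators.ell_eq_sum_smul`); the rest is the polynomial identity behind
`log`-bookkeeping in Rogers' `L`.  Consequently `x ↦ R(x)` factors through the five-term
relations: every consequence of the five-term functional equation among real algebraic
dilogarithm values is an identity of KZ classes.
-/
import Summits.KontsevichZagierPeriods.KontsevichZagierPeriods.Theorems.SoloBlindFiveTerm

noncomputable section

open MeasureTheory Set
open Literature.NumberTheory.Transcendental
open Literature.NumberTheory.Transcendental.KZ
open Literature.NumberTheory.Transcendental.KZ.IntegralRep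

namespace Summit.KontsevichZagierPeriods.KontsevichZagierPeriods.Theorems

namespace SoloBlind

/-! ## Additivity of the logarithmic classes -/

/-- `ℓ(ab) = ℓ(a) + ℓ(b)` for real algebraic `a, b > 1` (from `ell_eq_sum_smul`). -/
theorem ell_mul_of_one_lt {u v : ℝ} (hu : IsAlgebraic ℚ u) (hv : IsAlgebraic ℚ v) (h1u : 1 < u)
    (h1v : 1 < v) : ell (u * v) = ell u + ell v := by
  have h := ell_eq_sum_smul (hu.mul hv) (by nlinarith) ![u, v]
    (fun k => by fin_cases k <;> assumption) (fun k => by fin_cases k <;> assumption) (fun _ => 1)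
    (by rw [Fin.sum_univ_two, Real.log_mul (by linarith) (by linarith)]; simp)
  rw [h, Fin.sum_univ_two]
  simp

/-! ## The doubled Rogers class -/

variable (a c : Cut)

/-- **The doubled Rogers class** `R(x) = 2[D(x)] + ℓ(1/x)·ℓ(1/(1−x))`. -/
def rog : Q := 2 * mkQ (of (dilogCut a)) + ell a.x⁻¹ * ell (1 - a.x)⁻¹

/-- Its period: `2 Li₂(x) + log(1/x)·log(1/(1−x)) = 2 Li₂(x) + log x · log(1−x) = 2 L(x)`. -/
theorem evalQ_rog :
    evalQ (rog a) = 2 * (dilogCut a).value + Real.log a.x⁻¹ * Real.log (1 - a.x)⁻¹ := by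
  have e : evalQ (ell (1 - a.x)⁻¹) = Real.log (1 - a.x)⁻¹ :=
    evalQ_ell a.symm.alg_inv a.symm.one_lt_inv.le
  rw [rog, map_add, map_mul, map_mul, map_ofNat, evalQ_mkQ, eval_of,
    evalQ_ell a.alg_inv a.one_lt_inv.le, e]

/-! ## The logarithmic bookkeeping -/

/-- `1 < y/(y ⋆ x)`. -/
theorem one_lt_argA : 1 < (c.twist a).x⁻¹ * c.x := by
  rw [lt_inv_mul_iff₀ (c.twist a).pos, mul_one]
  exact Cut.twist_lt a c

/-- `ℓ(1/(1−x)) = ℓ(y/(y ⋆ x)) + ℓ(1/(1−xy))`. -/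
theorem ell_symm_fst : ell (1 - a.x)⁻¹ =
    ell ((c.twist a).x⁻¹ * c.x) + ell (1 - a.x * c.x)⁻¹ := by
  have e1 := (five_term_args a c).1
  have hx := a.symm_pos.ne'
  have hxy := (a.mul c).symm_pos.ne'
  have e : (c.twist a).x⁻¹ * c.x * (1 - a.x * c.x)⁻¹ = (1 - a.x)⁻¹ := by
    rw [e1, Cut.mul_x] at *
    field_simp
  rw [← e]
  exact ell_mul_of_one_lt ((c.twist a).alg_inv.mul c.alg) (a.mul c).symm.alg_inv
    (one_lt_argA a c) (a.mul c).symm.one_lt_inv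

/-- `ℓ(1/(1−y)) = ℓ(1/(1 − y ⋆ x)) + ℓ(1/(1−xy))`. -/
theorem ell_symm_snd : ell (1 - c.x)⁻¹ =
    ell (1 - (c.twist a).x)⁻¹ + ell (1 - a.x * c.x)⁻¹ := by
  have e2 := (five_term_args a c).2
  have hy := c.symm_pos.ne'
  have hxy := (a.mul c).symm_pos.ne'
  have e : (1 - (c.twist a).x)⁻¹ * (1 - a.x * c.x)⁻¹ = (1 - c.x)⁻¹ := by
    rw [e2, Cut.mul_x] at *
    field_simp
  rw [← e]
  exact ell_mul_of_one_lt (c.twist a).symm.alg_inv (a.mul c).symm.alg_inv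
    (c.twist a).symm.one_lt_inv (a.mul c).symm.one_lt_inv

/-- `ℓ(1/(xy)) = ℓ(1/x) + ℓ(1/y)`. -/
theorem ell_mul_inv : ell (a.x * c.x)⁻¹ = ell a.x⁻¹ + ell c.x⁻¹ := by
  rw [mul_inv]
  exact ell_mul_of_one_lt a.alg_inv c.alg_inv a.one_lt_inv c.one_lt_inv

/-- `ℓ(1/(x ⋆ y)) = ℓ(1/(1 − y ⋆ x)) + ℓ(1/x)`. -/
theorem ell_twist_inv : ell (a.twist c).x⁻¹ = ell (1 - (c.twist a).x)⁻¹ + ell a.x⁻¹ := by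
  have e2 := (five_term_args a c).2
  have hx := a.pos.ne'
  have hy := c.symm_pos.ne'
  have hd := (c.twistDen_pos a).ne'
  have hd' : 1 - c.x * a.x ≠ 0 := by rwa [mul_comm] at hd
  have e : (1 - (c.twist a).x)⁻¹ * a.x⁻¹ = (a.twist c).x⁻¹ := by
    rw [e2, Cut.twist_x]
    field_simp
  rw [← e]
  exact ell_mul_of_one_lt (c.twist a).symm.alg_inv a.alg_inv (c.twist a).symm.one_lt_inv
    a.one_lt_inv

/-- `ℓ(1/(y ⋆ x)) = ℓ(y/(y ⋆ x)) + ℓ(1/y)`. -/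
theorem ell_cotwist_inv : ell (c.twist a).x⁻¹ = ell ((c.twist a).x⁻¹ * c.x) + ell c.x⁻¹ := by
  have e : (c.twist a).x⁻¹ * c.x * c.x⁻¹ = (c.twist a).x⁻¹ :=
    mul_inv_cancel_right₀ c.pos.ne' _
  rw [← ell_mul_of_one_lt ((c.twist a).alg_inv.mul c.alg) c.alg_inv (one_lt_argA a c)
    c.one_lt_inv, e]

/-- `1/(1 − x ⋆ y) = y/(y ⋆ x)` (`= (1−xy)/(1−x)`). -/
theorem inv_one_sub_twist : (1 - (a.twist c).x)⁻¹ = (c.twist a).x⁻¹ * c.x := by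
  rw [(five_term_args c a).2, (five_term_args a c).1, mul_comm c.x a.x]

/-! ## Rogers' five-term relation -/

/-- **Rogers' five-term relation in `Q`.** For all real algebraic cuts `x, y`:
`R(x) + R(y) − R(xy) − R(x ⋆ y) − R(y ⋆ x) = 0`. -/
theorem rogers_five_term :
    rog a + rog c - rog (a.mul c) - rog (a.twist c) - rog (c.twist a) = 0 := by
  have h := five_term a c
  simp only [rog, Cut.mul_x]
  rw [ell_symm_fst a c, ell_symm_snd a c, ell_mul_inv a c, ell_twist_inv a c, inv_one_sub_twist a c,
    ell_cotwist_inv a c]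
  linear_combination 2 * h

/-- **Period shadow (Rogers' identity).** With `L(x) = Li₂(x) + ½ log x · log(1−x)`:
`L(x) + L(y) = L(xy) + L(x ⋆ y) + L(y ⋆ x)`, written for `2L`. -/
theorem rogers_five_term_value :
    (2 * (dilogCut a).value + Real.log a.x⁻¹ * Real.log (1 - a.x)⁻¹) +
        (2 * (dilogCut c).value + Real.log c.x⁻¹ * Real.log (1 - c.x)⁻¹) -
        (2 * (dilogCut (a.mul c)).value +
          Real.log (a.mul c).x⁻¹ * Real.log (1 - (a.mul c).x)⁻¹) -
        (2 * (dilogCut (a.twist c)).value +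
          Real.log (a.twist c).x⁻¹ * Real.log (1 - (a.twist c).x)⁻¹) -
        (2 * (dilogCut (c.twist a)).value +
          Real.log (c.twist a).x⁻¹ * Real.log (1 - (c.twist a).x)⁻¹) = 0 := by
  have h := congrArg evalQ (rogers_five_term a c)
  simpa only [map_sub, map_add, map_zero, evalQ_rog] using h

end SoloBlind

end Summit.KontsevichZagierPeriods.KontsevichZagierPeriods.Theorems
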